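import Summits.SmoothPoincare4.SmoothPoincare4.Theorems.EntropyRungNoncompactShrinkerGapHeatHypoellipticNoncompactAux
import HarnessLib

/-!
# Heat hypoellipticity on a non-compact manifold: the very weak equation in a space-time chart
(crux `EntropyRung.NoncompactShrinkerGap`, stmt-SmoothPoincare4-10868, line `collapsed-ends-usc`, v13)

Verbatim re-proof of `Literature.Geometry.Riemannian.integral_heatTranspose_chart_of_veryWeak`
(`LinearHeatWeakRegularity.lean`) with `[CompactSpace M]` replaced by
`[T3Space M] [SecondCountableTopology M]`: compactness was used there only to synthesise `T3`
(to state `dV_{g₀}`) and to get `SFinite dV_{g₀}` for Fubini; here `dV_{g₀}` is finite on compact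
sets (`riemannianVolume_lt_top_of_isCompact_holds`) on a locally compact second-countable space,
hence σ-finite. Result: `integral_heatTranspose_chart_of_veryWeak_nc` — a very weak solution of
`∂ₛu = Δ_{h(s)}u − Qu + G` on `M × T` read in the chart `φ × id` satisfies
`∫ ū · heatTranspose A J q ψ = ∫ F ψ` (`J = √det h(s)ᵢⱼ`, `A = J h(s)⁻¹`, `q = JQ`, `F = JG`).
References: I. Chavel, *Riemannian Geometry*, 2nd ed., CUP 2006, §III.3 (III.3.6), §III.7
[Chavel2006]; L. Hörmander, Acta Math. 119 (1967) 147–171 [Hormander1967].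
-/

noncomputable section

set_option linter.dupNamespace false

open Bundle Set Function Filter MeasureTheory Measure TopologicalSpace
open scoped Manifold ContDiff Topology Matrix ENNReal
open Literature.Geometry.Riemannian Literature.Geometry.Lorentzian
  Literature.Geometry.Lorentzian.PseudoRiemannianMetric Literature.Analysis.Distribution

namespace Summit.SmoothPoincare4.SmoothPoincare4.Theorems.NoncompactShrinkerGapHeat

variable {m : ℕ} {H : Type*} [TopologicalSpace H]
  {I : ModelWithCorners ℝ (EuclideanSpace ℝ (Fin m)) H}
  {M : Type*} [TopologicalSpace M] [ChartedSpace H M]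
  [IsManifold I ∞ M] [I.Boundaryless] [T3Space M] [SecondCountableTopology M] [MeasurableSpace M] [BorelSpace M]
  {h : ℝ → PseudoRiemannianMetric I ∞ (EuclideanSpace ℝ (Fin m)) (TangentSpace I : M → Type _)}
  {g₀ : PseudoRiemannianMetric I ∞ (EuclideanSpace ℝ (Fin m)) (TangentSpace I : M → Type _)}

/-- **The very weak heat equation read in a space-time chart** (non-compact `M`). For a family
`h(s)` of Riemannian metrics on `M`, `C^∞` on `M × ℝ`, a Riemannian reference metric `g₀` with
density ratio `ρ = dV_{h(s)}/dV_{g₀}`, `Q, G` smooth on `M × ℝ`, and a measurable `u` with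
`∫ u · (−∂ₛ(ρζ) − ρ Δ_{h(s)}ζ + ρQζ) d(V_{g₀} ⊗ ds) = ∫ ρ G ζ d(V_{g₀} ⊗ ds)` for all smooth `ζ`
compactly supported in `M × T`, the chart representative `ū(y, s) = u(φ⁻¹y, s)` satisfies
`∫ ū · heatTranspose A J q ψ dy ds = ∫ F ψ dy ds` for every smooth `ψ` compactly supported in
`φ.target × T` (`J = √det h(s)ᵢⱼ`, `A = J h(s)⁻¹`, `q = J Q`, `F = J G`): divergence form of the
coordinate Laplacian (`coordLaplacian_mul_sqrt_det_eq_sum_fderiv`, `dalembertian_eq_sum_localFrame`),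
chart formula `dV_{g₀} = √det (g₀)ᵢⱼ dy` (`integral_eq_integral_chart`),
`ρ √det (g₀)ᵢⱼ = √det h(s)ᵢⱼ` (`densityRatio_mul_sqrt_det_chartGramMatrix`), Fubini in time.
[cite: Chavel2006, §III.3 (III.3.6) and §III.7] -/
theorem integral_heatTranspose_chart_of_veryWeak_nc
    (hh : IsContMDiffFamilyOn ∞ h univ) (hR : ∀ s, (h s).IsRiemannian) (hR₀ : g₀.IsRiemannian)
    {Q G : ℝ → M → ℝ} (hQ : ContMDiff (I.prod 𝓘(ℝ, ℝ)) 𝓘(ℝ, ℝ) ∞ fun p : M × ℝ ↦ Q p.2 p.1)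
    (hG : ContMDiff (I.prod 𝓘(ℝ, ℝ)) 𝓘(ℝ, ℝ) ∞ fun p : M × ℝ ↦ G p.2 p.1)
    {T : Set ℝ} (hT : IsOpen T) {u : M × ℝ → ℝ} (hum : Measurable u)
    (hu : LocallyIntegrableOn u (univ ×ˢ T) (g₀.riemVolume.prod (volume : Measure ℝ)))
    (hweak : ∀ ζ : M × ℝ → ℝ, ContMDiff (I.prod 𝓘(ℝ, ℝ)) 𝓘(ℝ, ℝ) ∞ ζ → HasCompactSupport ζ →
      tsupport ζ ⊆ univ ×ˢ T →
      ∫ p, u p * (-(deriv (fun s ↦ (h s).densityRatio g₀ p.1 * ζ (p.1, s)) p.2) -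
          (h p.2).densityRatio g₀ p.1 * (h p.2).laplaceBeltrami (fun x ↦ ζ (x, p.2)) p.1 +
          (h p.2).densityRatio g₀ p.1 * Q p.2 p.1 * ζ p) ∂g₀.riemVolume.prod (volume : Measure ℝ) =
        ∫ p, (h p.2).densityRatio g₀ p.1 * G p.2 p.1 * ζ p ∂g₀.riemVolume.prod (volume : Measure ℝ))
    (x₀ : M) (Jc qc Fc : (EuclideanSpace ℝ (Fin m) × ℝ) → ℝ) (Ac : Fin m → Fin m → (EuclideanSpace ℝ (Fin m) × ℝ) → ℝ)
    (hJc : ∀ q, Jc q = Real.sqrt (chartGramMatrix ((h q.2).toContMDiffRiemannianMetric (hR q.2)) x₀ q.1).det)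
    (hAc : ∀ k l q, Ac k l q =
      Jc q * (chartGramMatrix ((h q.2).toContMDiffRiemannianMetric (hR q.2)) x₀ q.1)⁻¹ k l)
    (hqc : ∀ q, qc q = Jc q * Q q.2 ((extChartAt I x₀).symm q.1))
    (hFc : ∀ q, Fc q = Jc q * G q.2 ((extChartAt I x₀).symm q.1))
    {ψ : (EuclideanSpace ℝ (Fin m) × ℝ) → ℝ} (hψ : ContDiff ℝ ∞ ψ) (hψc : HasCompactSupport ψ)
    (hψT : tsupport ψ ⊆ (extChartAt I x₀).target ×ˢ T) :
    ∫ q, u ((extChartAt I x₀).symm q.1, q.2) * heatTranspose Ac Jc qc ψ q =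
      ∫ q, Fc q * ψ q := by
  classical
  -- notation
  set φ := extChartAt I x₀ with hφ
  set e := trivializationAt (EuclideanSpace ℝ (Fin m)) (TangentSpace I) x₀ with he
  set μ₀ : Measure M := g₀.riemVolume with hμ₀
  have hV : IsOpen φ.target := isOpen_extChartAt_target x₀
  have hO : IsOpen (φ.target ×ˢ (univ : Set ℝ)) := hV.prod isOpen_univ
  haveI : LocallyCompactSpace M := Manifold.locallyCompact_of_finiteDimensional (M := M) I
  haveI : IsFiniteMeasureOnCompacts μ₀ := by
    rw [hμ₀, riemVolume_eq hR₀]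
    exact ⟨fun K hK ↦ riemannianVolume_lt_top_of_isCompact_holds _ le_rfl hK⟩
  have hψT' : tsupport ψ ⊆ φ.target ×ˢ (univ : Set ℝ) := hψT.trans (prod_mono le_rfl (subset_univ _))
  have hsrc : (chartAt H x₀).source = φ.source := (extChartAt_source (I := I) (x := x₀)).symm
  -- the density ratio and its chart identity
  set ρ : M × ℝ → ℝ := fun p ↦ (h p.2).densityRatio g₀ p.1 with hρ
  have hρs : ContMDiff (I.prod 𝓘(ℝ, ℝ)) 𝓘(ℝ, ℝ) ∞ ρ := by
    have h1 := hh.contMDiffOn_densityRatio (fun s _ ↦ hR s) hR₀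
    rw [univ_prod_univ] at h1; exact contMDiffOn_univ.1 h1
  have hρJ : ∀ (y : EuclideanSpace ℝ (Fin m)) (s : ℝ), y ∈ φ.target →
      ρ (φ.symm y, s) * Real.sqrt (chartGramMatrix (g₀.toContMDiffRiemannianMetric hR₀) x₀ y).det =
        Jc (y, s) := by
    intro y s hy; rw [hJc]; exact densityRatio_mul_sqrt_det_chartGramMatrix (hR s) hR₀ x₀ hy
  have hJ0pos : ∀ y ∈ φ.target, 0 < Real.sqrt (chartGramMatrix (g₀.toContMDiffRiemannianMetric hR₀) x₀ y).det :=
    fun y hy ↦ sqrt_det_chartGramMatrix_pos _ x₀ hy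
  -- the Gram family in the chart and the smoothness of the chart data on `φ.target × ℝ`
  set Gh : (EuclideanSpace ℝ (Fin m) × ℝ) → Fin m → Fin m → ℝ := fun q i j ↦
    chartGramMatrix ((h q.2).toContMDiffRiemannianMetric (hR q.2)) x₀ q.1 i j with hGh
  have hofG : ∀ q, Matrix.of (Gh q) = chartGramMatrix ((h q.2).toContMDiffRiemannianMetric (hR q.2)) x₀ q.1 :=
    fun q ↦ by ext i j; rfl
  have hGval : ∀ q ∈ φ.target ×ˢ (univ : Set ℝ), ∀ i j, Gh q i j =
      (h q.2).val (φ.symm q.1) (e.localFrame (EuclideanSpace.basisFun (Fin m) ℝ).toBasis i (φ.symm q.1)) (e.localFrame (EuclideanSpace.basisFun (Fin m) ℝ).toBasis j (φ.symm q.1)) := by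
    intro q hq i j
    exact chartGramMatrix_apply_eq_val_localFrame _ x₀ hq.1 i j
  have hGs : ∀ i j, ContDiffOn ℝ ∞ (fun q ↦ Gh q i j) (φ.target ×ˢ (univ : Set ℝ)) := fun i j ↦
    (hh.contDiffOn_gram_chart x₀ (EuclideanSpace.basisFun (Fin m) ℝ).toBasis i j).congr fun q hq ↦ hGval q hq i j
  have hGsymm : ∀ q i j, Gh q i j = Gh q j i := fun q i j ↦ chartGramMatrix_apply_comm _ x₀ q.1 i j
  have hdetpos : ∀ q ∈ φ.target ×ˢ (univ : Set ℝ), 0 < (Matrix.of (Gh q)).det := fun q hq ↦ by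
    rw [hofG]; exact Real.sqrt_pos.1 (sqrt_det_chartGramMatrix_pos _ x₀ hq.1)
  have hGdet : ContDiffOn ℝ ∞ (fun q ↦ (Matrix.of (Gh q)).det) (φ.target ×ˢ (univ : Set ℝ)) := by
    intro q hq
    have h1 := contMDiffWithinAt_matrix_det (J := 𝓘(ℝ, (EuclideanSpace ℝ (Fin m) × ℝ))) (k := ∞)
      (A := fun q ↦ Matrix.of (Gh q)) (s := φ.target ×ˢ (univ : Set ℝ)) (x₀ := q)
      (fun i j ↦ contMDiffWithinAt_iff_contDiffWithinAt.2 (hGs i j q hq))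
    exact contMDiffWithinAt_iff_contDiffWithinAt.1 h1
  have hJcs : ContDiffOn ℝ ∞ Jc (φ.target ×ˢ (univ : Set ℝ)) := by
    have : Jc = fun q ↦ Real.sqrt (Matrix.of (Gh q)).det := funext fun q ↦ by rw [hJc, hofG]
    rw [this]; exact hGdet.sqrt fun q hq ↦ (hdetpos q hq).ne'
  have hGinv : ∀ i l, ContDiffOn ℝ ∞ (fun q ↦ (Matrix.of (Gh q))⁻¹ i l) (φ.target ×ˢ (univ : Set ℝ)) := by
    intro i l q hq
    have h1 := contMDiffWithinAt_matrix_inv (J := 𝓘(ℝ, (EuclideanSpace ℝ (Fin m) × ℝ))) (k := ∞)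
      (A := fun q ↦ Matrix.of (Gh q)) (s := φ.target ×ˢ (univ : Set ℝ)) (x₀ := q)
      (fun i j ↦ contMDiffWithinAt_iff_contDiffWithinAt.2 (hGs i j q hq)) (hdetpos q hq).ne' i l
    exact contMDiffWithinAt_iff_contDiffWithinAt.1 h1
  have hAcs : ∀ k l, ContDiffOn ℝ ∞ (Ac k l) (φ.target ×ˢ (univ : Set ℝ)) := fun k l ↦ by
    have : Ac k l = fun q ↦ Jc q * (Matrix.of (Gh q))⁻¹ k l := funext fun q ↦ by rw [hAc, hofG]
    rw [this]; exact hJcs.mul (hGinv k l)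
  have hQch : ContDiffOn ℝ ∞ (fun q : (EuclideanSpace ℝ (Fin m) × ℝ) ↦ Q q.2 (φ.symm q.1)) (φ.target ×ˢ (univ : Set ℝ)) :=
    contDiffOn_time_chart (k := (⊤ : ℕ∞)) hQ.contMDiffOn x₀
  have hGch : ContDiffOn ℝ ∞ (fun q : (EuclideanSpace ℝ (Fin m) × ℝ) ↦ G q.2 (φ.symm q.1)) (φ.target ×ˢ (univ : Set ℝ)) :=
    contDiffOn_time_chart (k := (⊤ : ℕ∞)) hG.contMDiffOn x₀
  have hqcs : ContDiffOn ℝ ∞ qc (φ.target ×ˢ (univ : Set ℝ)) := by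
    rw [show qc = fun q ↦ Jc q * Q q.2 (φ.symm q.1) from funext hqc]; exact hJcs.mul hQch
  -- the test function on `M × ℝ`
  obtain ⟨ζ, hζdef⟩ : ∃ ζ : M × ℝ → ℝ, ζ = ((chartAt H x₀).source ×ˢ (univ : Set ℝ)).indicator
      fun p : M × ℝ ↦ ψ (extChartAt I x₀ p.1, p.2) := ⟨_, rfl⟩
  have hζs : ContMDiff (I.prod 𝓘(ℝ, ℝ)) 𝓘(ℝ, ℝ) ∞ ζ :=
    hζdef ▸ contMDiff_indicator_comp_extChartAt_prod x₀ hψ hψc hψT'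
  have hζc : HasCompactSupport ζ := hζdef ▸ hasCompactSupport_indicator_comp_extChartAt_prod x₀ hψc hψT'
  have hζT : tsupport ζ ⊆ univ ×ˢ T :=
    hζdef ▸ tsupport_indicator_comp_extChartAt_prod_subset_time x₀ hψc hψT
  obtain ⟨hts, hKc, hKS⟩ := tsupport_indicator_comp_extChartAt_prod_subset (I := I) x₀ hψc hψT'
  have hζsupp : tsupport ζ ⊆ φ.source ×ˢ (univ : Set ℝ) := by rw [hζdef, ← hsrc]; exact hts.trans hKS
  have hζψ : ∀ (y : EuclideanSpace ℝ (Fin m)) (s : ℝ), y ∈ φ.target → ζ (φ.symm y, s) = ψ (y, s) := by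
    intro y s hy; rw [hζdef]; exact indicator_comp_extChartAt_prod_symm_apply x₀ ψ hy s
  -- the weak identity for `ζ`
  have hW := hweak ζ hζs hζc hζT
  -- abbreviations for the manifold-side integrands
  set Tζ : M × ℝ → ℝ := fun p ↦ -(deriv (fun s ↦ (h s).densityRatio g₀ p.1 * ζ (p.1, s)) p.2) -
      (h p.2).densityRatio g₀ p.1 * (h p.2).laplaceBeltrami (fun x ↦ ζ (x, p.2)) p.1 +
      (h p.2).densityRatio g₀ p.1 * Q p.2 p.1 * ζ p with hTζ
  set Rζ : M × ℝ → ℝ := fun p ↦ (h p.2).densityRatio g₀ p.1 * G p.2 p.1 * ζ p with hRζ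
  -- smoothness of the manifold-side integrands
  have hρζ : ContMDiff (I.prod 𝓘(ℝ, ℝ)) 𝓘(ℝ, ℝ) ∞ fun p : M × ℝ ↦ ρ p * ζ p := hρs.mul hζs
  have hDt : ContMDiff (I.prod 𝓘(ℝ, ℝ)) 𝓘(ℝ, ℝ) ∞
      fun p : M × ℝ ↦ deriv (fun s ↦ (h s).densityRatio g₀ p.1 * ζ (p.1, s)) p.2 := by
    have h1 := contMDiffOn_derivWithin_time_of_uniqueDiffOn (I := I) (M := M)
      (u := fun s x ↦ (h s).densityRatio g₀ x * ζ (x, s)) (S := univ) uniqueDiffOn_univ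
      (by rw [univ_prod_univ]; exact hρζ.contMDiffOn)
    rw [univ_prod_univ] at h1
    simpa only [derivWithin_univ] using contMDiffOn_univ.1 h1
  have hΔ : ContMDiff (I.prod 𝓘(ℝ, ℝ)) 𝓘(ℝ, ℝ) ∞
      fun p : M × ℝ ↦ (h p.2).laplaceBeltrami (fun x ↦ ζ (x, p.2)) p.1 := by
    have h1 := hh.contMDiffOn_laplaceBeltrami uniqueDiffOn_univ (f := fun s x ↦ ζ (x, s))
      (by rw [univ_prod_univ]; exact hζs.contMDiffOn)
    rw [univ_prod_univ] at h1; exact contMDiffOn_univ.1 h1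
  have hTζs : ContMDiff (I.prod 𝓘(ℝ, ℝ)) 𝓘(ℝ, ℝ) ∞ Tζ :=
    (hDt.neg.sub (hρs.mul hΔ)).add ((hρs.mul hQ).mul hζs)
  have hRζs : ContMDiff (I.prod 𝓘(ℝ, ℝ)) 𝓘(ℝ, ℝ) ∞ Rζ := (hρs.mul hG).mul hζs
  -- both vanish off `tsupport ζ`
  have hslice0 : ∀ p : M × ℝ, p ∉ tsupport ζ → p.1 ∉ tsupport (fun x ↦ ζ (x, p.2)) := by
    rintro ⟨x, s⟩ hp hx
    have hev : ζ =ᶠ[𝓝 (x, s)] 0 := notMem_tsupport_iff_eventuallyEq.1 hp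
    have : (fun x' ↦ ζ (x', s)) =ᶠ[𝓝 x] 0 := by
      exact (show ContinuousAt (fun x' : M ↦ ((x', s) : M × ℝ)) x by fun_prop).eventually hev
    exact (notMem_tsupport_iff_eventuallyEq.2 this) hx
  have hT0 : ∀ p ∉ tsupport ζ, Tζ p = 0 := by
    rintro ⟨x, s⟩ hp
    have hev : ζ =ᶠ[𝓝 (x, s)] 0 := notMem_tsupport_iff_eventuallyEq.1 hp
    have hd : deriv (fun s' ↦ (h s').densityRatio g₀ x * ζ (x, s')) s = 0 := by
      have hc : ContinuousAt (fun s' : ℝ ↦ ((x, s') : M × ℝ)) s := by fun_prop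
      have h1 : (fun s' ↦ (h s').densityRatio g₀ x * ζ (x, s')) =ᶠ[𝓝 s] fun _ ↦ 0 := by
        filter_upwards [hc.eventually hev] with s' hs'
        rw [hs', Pi.zero_apply, mul_zero]
      rw [h1.deriv_eq]; exact deriv_const s 0
    haveI := (h s).hasLeviCivita
    have hΔ0 : (h s).laplaceBeltrami (fun x' ↦ ζ (x', s)) x = 0 := by
      rw [laplaceBeltrami_eq_dalembertian]
      exact dalembertian_eq_zero_of_notMem_tsupport _ (hslice0 (x, s) hp)
    have hζ0 : ζ (x, s) = 0 := image_eq_zero_of_notMem_tsupport hp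
    simp only [hTζ, hd, hΔ0, hζ0, mul_zero, neg_zero, sub_zero, add_zero]
  have hR0 : ∀ p ∉ tsupport ζ, Rζ p = 0 := fun p hp ↦ by simp only [hRζ, image_eq_zero_of_notMem_tsupport hp, mul_zero]
  -- integrability on `M × ℝ` and Fubini
  have hTζsupp : tsupport Tζ ⊆ tsupport ζ :=
    closure_minimal (fun p hp ↦ by_contra fun h' ↦ hp (hT0 p h')) (isClosed_tsupport ζ)
  have hRζsupp : tsupport Rζ ⊆ tsupport ζ :=
    closure_minimal (fun p hp ↦ by_contra fun h' ↦ hp (hR0 p h')) (isClosed_tsupport ζ)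
  have hTζc : HasCompactSupport Tζ := hζc.of_isClosed_subset (isClosed_tsupport _) hTζsupp
  have hRζc : HasCompactSupport Rζ := hζc.of_isClosed_subset (isClosed_tsupport _) hRζsupp
  have hint : Integrable (fun p ↦ u p * Tζ p) (μ₀.prod (volume : Measure ℝ)) :=
    integrable_mul_of_locallyIntegrableOn hu hTζs.continuous hTζc (hTζsupp.trans hζT)
  -- local integrability of the chart representative
  have hū : LocallyIntegrableOn (fun q : (EuclideanSpace ℝ (Fin m) × ℝ) ↦ u (φ.symm q.1, q.2)) (φ.target ×ˢ T)
      (volume : Measure (EuclideanSpace ℝ (Fin m) × ℝ)) := locallyIntegrableOn_comp_chart_prod_nc hR₀ x₀ hT hum hu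
  -- the chart-side transpose is smooth with compact support in `tsupport ψ`
  obtain ⟨hHs, hHc, hHsupp⟩ := heatTranspose_contDiff_of_tsupport hO hAcs hJcs hqcs hψ hψc hψT'
  -- (1) the slice identity for the left-hand side
  have hLslice : ∀ s : ℝ, ∫ x, u (x, s) * Tζ (x, s) ∂μ₀ =
      ∫ y, u (φ.symm y, s) * heatTranspose Ac Jc qc ψ (y, s) := by
    intro s
    -- the integrand on `M` is supported in the chart domain
    have hmeas : Measurable fun x ↦ u (x, s) * Tζ (x, s) :=
      (hum.comp (measurable_id.prodMk measurable_const)).mul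
        (hTζs.continuous.comp (continuous_id.prodMk continuous_const)).measurable
    have hsupp : support (fun x ↦ u (x, s) * Tζ (x, s)) ⊆ φ.source := by
      intro x hx
      rw [mem_support] at hx
      have hx' : Tζ (x, s) ≠ 0 := right_ne_zero_of_mul hx
      have : (x, s) ∈ tsupport ζ := by_contra fun h' ↦ hx' (hT0 _ h')
      exact (hζsupp this).1
    rw [hμ₀, riemVolume_eq hR₀, integral_eq_integral_chart _ x₀ hmeas hsupp]
    -- pointwise identity on the target
    have hpt : ∀ y ∈ φ.target,
        Real.sqrt (chartGramMatrix (g₀.toContMDiffRiemannianMetric hR₀) x₀ y).det •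
          (u (φ.symm y, s) * Tζ (φ.symm y, s)) =
        u (φ.symm y, s) * heatTranspose Ac Jc qc ψ (y, s) := by
      intro y hy
      have hq : ((y, s) : (EuclideanSpace ℝ (Fin m) × ℝ)) ∈ φ.target ×ˢ (univ : Set ℝ) := ⟨hy, mem_univ _⟩
      have hyx : φ.symm y ∈ (chartAt H x₀).source := by rw [hsrc]; exact φ.map_target hy
      set J0 : ℝ := Real.sqrt (chartGramMatrix (g₀.toContMDiffRiemannianMetric hR₀) x₀ y).det
        with hJ0
      have hJ0p : 0 < J0 := hJ0pos y hy
      -- (a) the time-derivative term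
      have ha : J0 * deriv (fun s' ↦ (h s').densityRatio g₀ (φ.symm y) * ζ (φ.symm y, s')) s =
          fderiv ℝ (fun z ↦ Jc z * ψ z) (y, s) ((0 : EuclideanSpace ℝ (Fin m)), (1 : ℝ)) := by
        have hfun : (fun s' ↦ (h s').densityRatio g₀ (φ.symm y) * ζ (φ.symm y, s')) =
            fun s' ↦ J0⁻¹ * (Jc (y, s') * ψ (y, s')) := by
          funext s'
          have h1 := hρJ y s' hy
          simp only [hρ] at h1
          rw [hζψ y s' hy, ← h1, hJ0]
          have hne : Real.sqrt (chartGramMatrix (g₀.toContMDiffRiemannianMetric hR₀) x₀ y).det ≠ 0 :=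
            (hJ0pos y hy).ne'
          field_simp
        rw [hfun, deriv_const_mul_field', ← mul_assoc, mul_inv_cancel₀ hJ0p.ne', one_mul]
        exact deriv_slice_right (((hJcs.mul hψ.contDiffOn).contDiffAt (hO.mem_nhds hq)).differentiableAt
          (by simp))
      -- (b) the Laplacian term
      have hb : J0 * ((h s).densityRatio g₀ (φ.symm y) *
          (h s).laplaceBeltrami (fun x ↦ ζ (x, s)) (φ.symm y)) =
          ∑ k, fderiv ℝ (fun z ↦ ∑ l, Ac k l z * fderiv ℝ ψ z ((EuclideanSpace.basisFun (Fin m) ℝ).toBasis l, 0)) (y, s) ((EuclideanSpace.basisFun (Fin m) ℝ).toBasis k, 0) := by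
        -- the slice functions in the chart
        set Ghs : EuclideanSpace ℝ (Fin m) → Fin m → Fin m → ℝ := fun z i j ↦ Gh (z, s) i j with hGhs
        set ψs : EuclideanSpace ℝ (Fin m) → ℝ := fun z ↦ ψ (z, s) with hψs
        have hψss : ContDiff ℝ ∞ ψs := hψ.comp (contDiff_id.prodMk contDiff_const)
        have hψs2 : ContDiff ℝ 2 ψs := hψss.of_le (by norm_cast)
        have hGhs_s : ∀ i j, ContDiffOn ℝ ∞ (fun z ↦ Ghs z i j) φ.target := fun i j ↦
          (hGs i j).comp (contDiffOn_id.prodMk contDiffOn_const) fun z hz ↦ ⟨hz, mem_univ _⟩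
        have hGhs_pi : ContDiffOn ℝ ∞ Ghs φ.target :=
          contDiffOn_pi.2 fun i ↦ contDiffOn_pi.2 fun j ↦ hGhs_s i j
        have hGy : HasFDerivAt Ghs (fderiv ℝ Ghs y) y :=
          ((hGhs_pi.contDiffAt (hV.mem_nhds hy)).differentiableAt (by simp)).hasFDerivAt
        have hf2y : HasFDerivAt (fun z ↦ fderiv ℝ ψs z) (fderiv ℝ (fderiv ℝ ψs) y) y :=
          (((hψs2.fderiv_right (m := 1) (by norm_num)).contDiffAt).differentiableAt
            one_ne_zero).hasFDerivAt
        have hζslice : CMDiff ∞ (fun x ↦ ζ (x, s)) := hζs.comp (contMDiff_id.prodMk contMDiff_const)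
        have hζ2 : CMDiffAt 2 (fun x ↦ ζ (x, s)) (φ.symm y) := (hζslice.of_le (by norm_cast)) _
        haveI := (h s).hasLeviCivita
        have hL := dalembertian_eq_sum_localFrame (h s) (EuclideanSpace.basisFun (Fin m) ℝ).toBasis hyx hζ2 (Gh := Ghs) (fh := ψs) (by
            rw [φ.right_inv hy]
            filter_upwards [hV.mem_nhds hy] with z hz
            intro i j
            exact hGval (z, s) ⟨hz, mem_univ _⟩ i j) (by
            rw [φ.right_inv hy]
            filter_upwards [hV.mem_nhds hy] with z hz
            simp only [hψs, Function.comp_apply]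
            exact (hζψ z s hz).symm)
        rw [φ.right_inv hy] at hL
        have hdety : 0 < (Matrix.of (Ghs y)).det := hdetpos (y, s) hq
        have hGsymm' : ∀ z i j, Ghs z i j = Ghs z j i := fun z i j ↦ hGsymm (z, s) i j
        have hC := Literature.Analysis.Calculus.coordLaplacian_mul_sqrt_det_eq_sum_fderiv (EuclideanSpace.basisFun (Fin m) ℝ).toBasis hGy
          hGsymm' hdety hf2y
        rw [(h s).laplaceBeltrami_eq_dalembertian, hL]
        simp only [Literature.Analysis.Calculus.fderiv_apply_apply_eq hGy] at hC ⊢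
        -- `J0 * ρ = Jc (y, s) = √det (Ghs y)`
        have hJρ : J0 * (h s).densityRatio g₀ (φ.symm y) = Real.sqrt (Matrix.of (Ghs y)).det := by
          rw [mul_comm]
          have := hρJ y s hy
          simp only [hρ] at this
          rw [this, hJc, hofG]
        rw [← mul_assoc, hJρ, hC]
        -- convert slice derivatives to space-time derivatives
        refine Finset.sum_congr rfl fun k _ ↦ ?_
        have hWk : ContDiffOn ℝ ∞ (fun z ↦ ∑ l, Ac k l z * fderiv ℝ ψ z ((EuclideanSpace.basisFun (Fin m) ℝ).toBasis l, 0))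
            (φ.target ×ˢ (univ : Set ℝ)) :=
          ContDiffOn.sum fun l _ ↦ (hAcs k l).mul
            ((hψ.fderiv_right (m := ∞) (by exact_mod_cast le_top)).clm_apply contDiff_const).contDiffOn
        have hev : (fun z ↦ Real.sqrt (Matrix.of (Ghs z)).det *
            ∑ l, (Matrix.of (Ghs z))⁻¹ k l * fderiv ℝ ψs z ((EuclideanSpace.basisFun (Fin m) ℝ).toBasis l)) =ᶠ[𝓝 y]
            fun z ↦ ∑ l, Ac k l (z, s) * fderiv ℝ ψ (z, s) ((EuclideanSpace.basisFun (Fin m) ℝ).toBasis l, 0) := by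
          filter_upwards [hV.mem_nhds hy] with z hz
          rw [Finset.mul_sum]
          refine Finset.sum_congr rfl fun l _ ↦ ?_
          rw [hAc, hJc, hofG, fderiv_slice_left (hψ.differentiable (by simp) _) ((EuclideanSpace.basisFun (Fin m) ℝ).toBasis l), mul_assoc]
        rw [hev.fderiv_eq]
        exact fderiv_slice_left ((hWk.contDiffAt (hO.mem_nhds hq)).differentiableAt (by simp)) ((EuclideanSpace.basisFun (Fin m) ℝ).toBasis k)
      -- (c) the potential term
      have hc : J0 * ((h s).densityRatio g₀ (φ.symm y) * Q s (φ.symm y) * ζ (φ.symm y, s)) =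
          qc (y, s) * ψ (y, s) := by
        rw [hqc, hζψ y s hy, ← hρJ y s hy]
        simp only [hρ]
        ring
      -- assemble
      rw [heatTranspose_apply, smul_eq_mul]
      simp only [hTζ]
      have : J0 * (-(deriv (fun s' ↦ (h s').densityRatio g₀ (φ.symm y) * ζ (φ.symm y, s')) s) -
          (h s).densityRatio g₀ (φ.symm y) * (h s).laplaceBeltrami (fun x ↦ ζ (x, s)) (φ.symm y) +
          (h s).densityRatio g₀ (φ.symm y) * Q s (φ.symm y) * ζ (φ.symm y, s)) =
          -(J0 * deriv (fun s' ↦ (h s').densityRatio g₀ (φ.symm y) * ζ (φ.symm y, s')) s) -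
            J0 * ((h s).densityRatio g₀ (φ.symm y) *
              (h s).laplaceBeltrami (fun x ↦ ζ (x, s)) (φ.symm y)) +
            J0 * ((h s).densityRatio g₀ (φ.symm y) * Q s (φ.symm y) * ζ (φ.symm y, s)) := by ring
      rw [mul_left_comm, this, ha, hb, hc]
    rw [setIntegral_congr_fun (measurableSet_extChartAt_target x₀) hpt,
      setIntegral_eq_integral_of_forall_compl_eq_zero]
    intro y hy
    have : ((y, s) : (EuclideanSpace ℝ (Fin m) × ℝ)) ∉ tsupport ψ := fun h' ↦ hy (hψT' h').1
    rw [heatTranspose_eq_zero_of_notMem_tsupport this, mul_zero]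
  -- (2) the slice identity for the right-hand side
  have hRslice : ∀ s : ℝ, ∫ x, Rζ (x, s) ∂μ₀ = ∫ y, Fc (y, s) * ψ (y, s) := by
    intro s
    have hmeas : Measurable fun x ↦ Rζ (x, s) :=
      (hRζs.continuous.comp (continuous_id.prodMk continuous_const)).measurable
    have hsupp : support (fun x ↦ Rζ (x, s)) ⊆ φ.source := by
      intro x hx
      rw [mem_support] at hx
      have : (x, s) ∈ tsupport ζ := by_contra fun h' ↦ hx (hR0 _ h')
      exact (hζsupp this).1
    rw [hμ₀, riemVolume_eq hR₀, integral_eq_integral_chart _ x₀ hmeas hsupp]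
    have hpt : ∀ y ∈ φ.target,
        Real.sqrt (chartGramMatrix (g₀.toContMDiffRiemannianMetric hR₀) x₀ y).det • Rζ (φ.symm y, s) =
        Fc (y, s) * ψ (y, s) := by
      intro y hy
      have h1 := hρJ y s hy
      simp only [hρ] at h1
      simp only [hRζ, smul_eq_mul]
      rw [hζψ y s hy, hFc, ← h1]
      ring
    rw [setIntegral_congr_fun (measurableSet_extChartAt_target x₀) hpt,
      setIntegral_eq_integral_of_forall_compl_eq_zero]
    intro y hy
    have : ((y, s) : (EuclideanSpace ℝ (Fin m) × ℝ)) ∉ tsupport ψ := fun h' ↦ hy (hψT' h').1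
    rw [image_eq_zero_of_notMem_tsupport this, mul_zero]
  -- (3) Fubini on both sides
  have hLHS : ∫ p, u p * Tζ p ∂μ₀.prod (volume : Measure ℝ) =
      ∫ q, u (φ.symm q.1, q.2) * heatTranspose Ac Jc qc ψ q := by
    rw [integral_prod_symm _ hint]
    simp_rw [hLslice]
    have hint' : Integrable (fun q : (EuclideanSpace ℝ (Fin m) × ℝ) ↦ u (φ.symm q.1, q.2) * heatTranspose Ac Jc qc ψ q)
        (volume : Measure (EuclideanSpace ℝ (Fin m) × ℝ)) :=
      integrable_mul_of_locallyIntegrableOn hū hHs.continuous hHc (hHsupp.trans hψT)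
    rw [show (volume : Measure (EuclideanSpace ℝ (Fin m) × ℝ)) = (volume : Measure (EuclideanSpace ℝ (Fin m))).prod
      (volume : Measure ℝ) from rfl] at hint' ⊢
    rw [integral_prod_symm _ hint']
  have hRHS : ∫ p, Rζ p ∂μ₀.prod (volume : Measure ℝ) = ∫ q, Fc q * ψ q := by
    have hintR : Integrable Rζ (μ₀.prod (volume : Measure ℝ)) :=
      hRζs.continuous.integrable_of_hasCompactSupport hRζc
    rw [integral_prod_symm _ hintR]
    simp_rw [hRslice]
    have hFcs : ContDiffOn ℝ ∞ Fc (φ.target ×ˢ (univ : Set ℝ)) := by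
      rw [show Fc = fun q ↦ Jc q * G q.2 (φ.symm q.1) from funext hFc]; exact hJcs.mul hGch
    have hFψ : ContDiff ℝ ∞ fun q ↦ Fc q * ψ q :=
      contDiff_of_contDiffOn_of_eq_zero hO hψc hψT' (hFcs.mul hψ.contDiffOn)
        fun q hq ↦ by rw [image_eq_zero_of_notMem_tsupport hq, mul_zero]
    have hFψc : HasCompactSupport fun q ↦ Fc q * ψ q := hψc.mul_left
    have hint' : Integrable (fun q : (EuclideanSpace ℝ (Fin m) × ℝ) ↦ Fc q * ψ q) (volume : Measure (EuclideanSpace ℝ (Fin m) × ℝ)) :=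
      hFψ.continuous.integrable_of_hasCompactSupport hFψc
    rw [show (volume : Measure (EuclideanSpace ℝ (Fin m) × ℝ)) = (volume : Measure (EuclideanSpace ℝ (Fin m))).prod
      (volume : Measure ℝ) from rfl] at hint' ⊢
    rw [integral_prod_symm _ hint']
  rw [← hLHS, ← hRHS]
  exact hW

/-- **Registered helper `helper_heatTransposeChart_noncompact`** (line `collapsed-ends-usc`):
`integral_heatTranspose_chart_of_veryWeak_nc` with all arguments explicit — the very weak heat
equation on a non-compact manifold read in a space-time chart. [cite: Chavel2006, §III.3 (III.3.6) and §III.7] -/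
theorem helper_heatTransposeChart_noncompact : ∀ (m : ℕ) (H : Type*) [TopologicalSpace H] (I : ModelWithCorners ℝ (EuclideanSpace ℝ (Fin m)) H) [I.Boundaryless] (M : Type*) [TopologicalSpace M] [ChartedSpace H M] [IsManifold I ∞ M] [T3Space M] [SecondCountableTopology M] [MeasurableSpace M] [BorelSpace M] (h : ℝ → PseudoRiemannianMetric I ∞ (EuclideanSpace ℝ (Fin m)) (TangentSpace I : M → Type _)) (g₀ : PseudoRiemannianMetric I ∞ (EuclideanSpace ℝ (Fin m)) (TangentSpace I : M → Type _)) (hh : IsContMDiffFamilyOn ∞ h univ) (hR : ∀ s, (h s).IsRiemannian) (hR₀ : g₀.IsRiemannian) (Q G : ℝ → M → ℝ), ContMDiff (I.prod 𝓘(ℝ, ℝ)) 𝓘(ℝ, ℝ) ∞ (fun p : M × ℝ ↦ Q p.2 p.1) → ContMDiff (I.prod 𝓘(ℝ, ℝ)) 𝓘(ℝ, ℝ) ∞ (fun p : M × ℝ ↦ G p.2 p.1) → ∀ (T : Set ℝ) (u : M × ℝ → ℝ), IsOpen T → Measurable u → LocallyIntegrableOn u (univ ×ˢ T) (g₀.riemVolume.prod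 (volume : Measure ℝ)) → (∀ ζ : M × ℝ → ℝ, ContMDiff (I.prod 𝓘(ℝ, ℝ)) 𝓘(ℝ, ℝ) ∞ ζ → HasCompactSupport ζ → tsupport ζ ⊆ univ ×ˢ T → ∫ p, u p * (-(deriv (fun s ↦ (h s).densityRatio g₀ p.1 * ζ (p.1, s)) p.2) - (h p.2).densityRatio g₀ p.1 * (h p.2).laplaceBeltrami (fun x ↦ ζ (x, p.2)) p.1 + (h p.2).densityRatio g₀ p.1 * Q p.2 p.1 * ζ p) ∂(g₀.riemVolume.prod (volume : Measure ℝ)) = ∫ p, (h p.2).densityRatio g₀ p.1 * G p.2 p.1 * ζ p ∂(g₀.riemVolume.prod (volume : Measure ℝ))) → ∀ (x₀ : M) (Jc qc Fc : EuclideanSpace ℝ (Fin m) × ℝ → ℝ) (Ac : Fin m → Fin m → EuclideanSpace ℝ (Fin m) × ℝ → ℝ), (∀ q, Jc q = Real.sqrt (chartGramMatrix ((h q.2).toContMDiffRiemannianMetric (hR q.2)) x₀ q.1).det) → (∀ k l q, Ac k l q = Jc q * (chartGramMatrix ((h q.2).toContMDiffRiemannianMetric (hR q.2)) x₀ q.1)⁻¹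 k l) → (∀ q, qc q = Jc q * Q q.2 ((extChartAt I x₀).symm q.1)) → (∀ q, Fc q = Jc q * G q.2 ((extChartAt I x₀).symm q.1)) → ∀ (ψ : EuclideanSpace ℝ (Fin m) × ℝ → ℝ), ContDiff ℝ ∞ ψ → HasCompactSupport ψ → tsupport ψ ⊆ (extChartAt I x₀).target ×ˢ T → ∫ q, u ((extChartAt I x₀).symm q.1, q.2) * Literature.Analysis.Distribution.heatTranspose Ac Jc qc ψ q = ∫ q, Fc q * ψ q := by
  intro m H _ I _ M _ _ _ _ _ _ _ h g₀ hh hR hR₀ Q G hQ hG T u hT hum hu hweak x₀ Jc qc Fc Ac hJc hAc hqc hFc ψ hψ hψc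
  exact integral_heatTranspose_chart_of_veryWeak_nc hh hR hR₀ hQ hG hT hum hu hweak x₀ Jc qc Fc Ac hJc hAc hqc hFc hψ hψc

end Summit.SmoothPoincare4.SmoothPoincare4.Theorems.NoncompactShrinkerGapHeat

end
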